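/-
Copyright (c) 2026 the pub-hodgecm-mathlib formalisation cell (harness21).  Prover seat hodgecm-mathlib-K2E4-p21 (g2), Track B «K2-LIT» ∕ h413,
line (ii′) «H-side central germ expansion» (lead K2E4-p06 (g2)), letter (S′) «EP witness on `H_v` with negative central value».  2026-09-04.
-/
import Literature.NumberTheory.Rogawski1990.RankOneEulerPoincareNonsplitCentralValue        -- ★ J2♯ (K2E4-p08): `rankOneEulerPoincareNonsplit_withCentralValue` (every non-split `v`)
import Literature.NumberTheory.Rogawski1990.LocalTransferCompactSideJunctionCM             -- ★ B-p08: `isHaarMeasure_map_fst_of_compactSpace`, `exists_isCanonical_cmDatum_local_two`, `compactSpace_cmDatum_local_one_of_smul_eq` (+ ★ PAIR `…comp_fst_eq_of_compactSpace_of_map_fst`)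
import Literature.NumberTheory.Automorphic.LocalUnitaryGroupCenter                            -- ★ `forall_mem_center_cmLocal_eq_scalar`
import Literature.NumberTheory.Automorphic.LocalOrbitalMeasureRegular                         -- ★ `isInvInvariant_localEndoscopic` (`H_v` unimodular)
import Literature.NumberTheory.Automorphic.UnitaryGroupOfLocalCovolumeStableKit               -- ★ `quotientMeasure_eq_zero_of_eq_zero`
import Literature.NumberTheory.Rogawski1990.RegularEltLocalisation                            -- ★ `isRegularElt_out_mk_local`
import Literature.MeasureTheory.Group.RightInvariantIsHaar                                    -- ★ `isHaarMeasure_of_isMulRightInvariant_of_ne_zero`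
import Summits.HodgeConjecture.HodgeConjecture.Theorems.F0P3cStCharTSEllMassHOrbEll           -- ★ `compactSpace_centralizer_fst_of_centralizerH` (+ ★ PAIR plumbing, `isLocalGRegular_of_isConj`, `isRegularElt_fst_snd_of_isLocalGRegular`)
import Summits.HodgeConjecture.HodgeConjecture.Theorems.K2E4WeakMatrixAlmostEverywhereAgreementRationalPair  -- ★ `exists_isGRegular_isNormPair` (a `G`-regular class exists)
import Literature.NumberTheory.Rogawski1990.TamagawaSingularMembersFinTFCovol                 -- ★ frame vocabulary of the U3b prefix (`IsLocalTransferDatum`, `IsCanonical`, …)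
import Literature.NumberTheory.Weil1982.UnitaryFinCentralizerTopFormHaar
import Literature.NumberTheory.Rogawski1990.FinExplicitTransferFactorConjLeft
import Literature.NumberTheory.Rogawski1990.FinExplicitTransferFactorConjRight
import Literature.NumberTheory.Rogawski1990.ArchCanonicalTransferFactor
import Literature.NumberTheory.Rogawski1990.ExplicitFactorProductFormula
import Literature.NumberTheory.Automorphic.QuadraticHeckeCharacterCM
import HarnessLib

/-!
# K2 · E3 · line (ii′) — (S′) THE EULER–POINCARÉ WITNESS ON `H_v = U(Φ₂)(L⁺_v) × U(Φ₁)(L⁺_v)` WITH ITS NEGATIVE CENTRAL VALUE, at EVERY non-split `v`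
# [Kottwitz1988 §2 Thm. 2; Rogawski1990 §12.6 p. 174, §8.1 p. 117 L1, §3.5 Prop. 3.5.2 (c)]

Cell `pub/hodgecm-mathlib` (D-0151), crux H413 = `stmt-HodgeConjecture-24833` (lane `--supports … --as helper`), route HCCMUnconditional; Track B «K2-LIT»,
E3 module `Cruxes/H413/Lines/K2_E3_EllipticInputsSigs_U3bCentralGerms.lean`, line (ii′) (lead K2E4-p06 (g2), dealer K2E3-plan (g1) 23:40:43Z (a)); seat K2E4-p21 (g2).
THEOREMS ONLY (no definition, no instance, no notation, no named fact, no `sorry`); ★-only imports.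

WHY (K2E4-p21 (g2) finding 2026-09-03T23:35:59Z).  The STABLE central germ of `H_v` along the elliptic `G`-regular filter at a central `z` is `nst(γ)·Γ₁` with
`nst(γ) = #{H_v-classes in the stable class of γ} ∈ {1, 2}` BY TORUS TYPE ([Rogawski1990] Prop. 3.5.2 (c): `|𝒟(T∕F)| = 2^{r−1}`; §3.6; ★
`LocalStableClassesNonsplitRankTwo`), so the sign sub-letters (S)∕(S♭) «one constant `C_H`∕`Γ₁` along the filter» are FALSE as typed, while the SIGN itself needs neither
[R₁] nor the constancy of `Γ_{⟦z⟧}`: with (E) at an Euler–Poincaré witness `f₀` (`Φ(⟦γ⟧, f₀) = κ > 0` on the elliptic `G`-regular classes, `f₀(z) = −r < 0`),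
`Φ^st(γ, fH) = (κ∕f₀(z))·nst(γ)·fH(z) + tails`.  THIS FILE pays that witness letter — (S′) `sig_K2E3CentralGermEPWitness` (cand `K2/K2E4-p21/g2/…` sha16 fe1cba6aeecc86e5,
U3b prefix VERBATIM) — OUTRIGHT at every non-split place:

* `centralGermEPWitness` : ‹(S′)› — for every central `z ∈ H_v` there are `f₀ ∈ C_c^∞(H_v)`, `r > 0`, `κ > 0` (here `κ = 1`) with `f₀ z = −r` and
  `Φ(⟦γ⟧, f₀; mHv) = κ` at every `G`-regular `γ` with compact centraliser.

PROOF (all ★).  `f₀ := f ∘ pr₁` for K2E4-p08's ★ J2♯ `rankOneEulerPoincareNonsplit_withCentralValue` on `U₂ = U(Φ₂)(L⁺_v)` (Kottwitz's `f_EP`, unramified AND ramified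
places, with `f(a·1) = −r`), read at the auxiliary Haar measure `(pr₁)_* νHv` and an auxiliary canonical family `m₂` (★ `OrbitalMeasureFamily.exists_isCanonical`); the
frame's `νHv` is upgraded to a Haar measure (`νHv ≠ 0` by admissibility of `mHv` at a `G`-regular class ★ `exists_isGRegular_isNormPair`, unimodularity ★
`isInvInvariant_localEndoscopic`); `(pr₁)_* νHv` is Haar because `U(Φ₁)(L⁺_v)` is COMPACT at a non-split `v` (★ `compactSpace_cmDatum_local_one_of_smul_eq`, Mathlib
`isHaarMeasure_map`); the orbital integrals transport EXACTLY by ★ B-p08's PAIR for canonical families `classOrbitalIntegral_comp_fst_eq_of_compactSpace_of_map_fst`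
(compactness of `Z(γ.1)` from that of `Z_H(γ)`, ★ `compactSpace_centralizer_fst_of_centralizerH`); a central `z` has scalar first component (★ `forall_mem_center_cmLocal_eq_scalar`).
HONEST LABEL: count-neutral helper until the dealer hosts (S′); HC_CM is proved only modulo the 7 printed citations (2 remaining named inputs: hLiu418 =
`stmt-HodgeConjecture-24832`, h413 = `stmt-HodgeConjecture-24833`) until rung 0 closes.

## References
* [Kottwitz1988] R. E. Kottwitz, *Tamagawa numbers*, Ann. of Math. 127 (1988), §2 Theorem 2.
* [Rogawski1990] J. D. Rogawski, *Automorphic Representations of Unitary Groups in Three Variables*, Ann. of Math. Stud. 123 (1990): §3.5 Prop. 3.5.2 (c) p. 29, §3.6,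
  §4.3 (4.3.1) p. 43, §8.1 p. 117, §12.6 p. 174.
* [Gelbart1975] S. Gelbart, *Automorphic forms on adele groups*, Ann. of Math. Studies 83 (1975), p. 155 (10.19).
-/

set_option autoImplicit false
-- the mandated namespace has the single-problem summit's repeated segment (`HodgeConjecture.HodgeConjecture`)
set_option linter.dupNamespace false

noncomputable section

open Filter Topology
open MeasureTheory Measure NumberField IsDedekindDomain
open Literature.MeasureTheory.Group
open Literature.NumberTheory.Rogawski1990 Literature.NumberTheory.Automorphic
open Literature.AlgebraicGeometry.ShimuraVarieties (unitaryGroup hermForm)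
open scoped Matrix MatrixGroups

namespace Summit.HodgeConjecture.HodgeConjecture.Cruxes.H413.K2E3CentralGermEPWitness

set_option maxHeartbeats 800000 in
set_option synthInstance.maxHeartbeats 200000 in
-- HB: the U3b prefix (33 binders, two carriers) plus auxiliary Borel structures on `U(Φ₂)(L⁺_v)` are elaborated in one declaration
/-- **(S′) THE EULER–POINCARÉ WITNESS ON `H_v` WITH NEGATIVE CENTRAL VALUE** — pays `U3bCentralGerms.sig_K2E3CentralGermEPWitness` (bytes VERBATIM) at EVERY non-split `v`:
under the U3b frame-light prefix, for every central `z ∈ H_v = U(Φ₂)(L⁺_v) × U(Φ₁)(L⁺_v)` there are `f₀ ∈ C_c^∞(H_v)` and reals `r, κ > 0` with `f₀ z = −r` and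
`Φ(⟦γ⟧, f₀; mHv) = κ` at every `G`-regular class with compact centraliser.  Witness: `f₀ = f_EP ∘ pr₁` (★ J2♯ on `U(Φ₂)(L⁺_v)`), `κ = 1`.
[cite: Kottwitz1988, §2 Theorem 2] [cite: Rogawski1990, §12.6 p. 174; §8.1 p. 117; §4.3 (4.3.1) p. 43] [cite: Gelbart1975, p. 155 (10.19)] -/
theorem centralGermEPWitness :
    ∀ (L : Type) [Field L] [NumberField L] [IsCMField L] (H' : Matrix (Fin 3) (Fin 3) L),
      (H'.map (cmConjRingHom L)).transpose = H' →
      (∀ x : Fin 3 → L, hermForm (cmConjRingHom L) H' x x = 0 → x = 0) →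
    ∀ (v : HeightOneSpectrum (𝓞 ↥(maximalRealSubfield L)))
      [MeasurableSpace ((UnitaryGroup.cmDatum L 2 (Matrix.of fun i j : Fin 2 => if i.val + j.val + 1 = 2 then (1 : L) else 0)).Local v × (UnitaryGroup.cmDatum L 1 (Matrix.of fun i j : Fin 1 => if i.val + j.val + 1 = 1 then (1 : L) else 0)).Local v)] [BorelSpace ((UnitaryGroup.cmDatum L 2 (Matrix.of fun i j : Fin 2 => if i.val + j.val + 1 = 2 then (1 : L) else 0)).Local v × (UnitaryGroup.cmDatum L 1 (Matrix.of fun i j : Fin 1 => if i.val + j.val + 1 = 1 then (1 : L) else 0)).Local v)]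
      [∀ a : (UnitaryGroup.cmDatum L 2 (Matrix.of fun i j : Fin 2 => if i.val + j.val + 1 = 2 then (1 : L) else 0)).Local v × (UnitaryGroup.cmDatum L 1 (Matrix.of fun i j : Fin 1 => if i.val + j.val + 1 = 1 then (1 : L) else 0)).Local v,
        MeasurableSpace (((UnitaryGroup.cmDatum L 2 (Matrix.of fun i j : Fin 2 => if i.val + j.val + 1 = 2 then (1 : L) else 0)).Local v × (UnitaryGroup.cmDatum L 1 (Matrix.of fun i j : Fin 1 => if i.val + j.val + 1 = 1 then (1 : L) else 0)).Local v) ⧸ Subgroup.centralizer ({a} : Set ((UnitaryGroup.cmDatum L 2 (Matrix.of fun i j : Fin 2 => if i.val + j.val + 1 = 2 then (1 : L) else 0)).Local v × (UnitaryGroup.cmDatum L 1 (Matrix.of fun i j : Fin 1 => if i.val + j.val + 1 = 1 then (1 : L) else 0)).Local v)))]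
      [∀ a : (UnitaryGroup.cmDatum L 2 (Matrix.of fun i j : Fin 2 => if i.val + j.val + 1 = 2 then (1 : L) else 0)).Local v × (UnitaryGroup.cmDatum L 1 (Matrix.of fun i j : Fin 1 => if i.val + j.val + 1 = 1 then (1 : L) else 0)).Local v,
        BorelSpace (((UnitaryGroup.cmDatum L 2 (Matrix.of fun i j : Fin 2 => if i.val + j.val + 1 = 2 then (1 : L) else 0)).Local v × (UnitaryGroup.cmDatum L 1 (Matrix.of fun i j : Fin 1 => if i.val + j.val + 1 = 1 then (1 : L) else 0)).Local v) ⧸ Subgroup.centralizer ({a} : Set ((UnitaryGroup.cmDatum L 2 (Matrix.of fun i j : Fin 2 => if i.val + j.val + 1 = 2 then (1 : L) else 0)).Local v × (UnitaryGroup.cmDatum L 1 (Matrix.of fun i j : Fin 1 => if i.val + j.val + 1 = 1 then (1 : L) else 0)).Local v)))]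
      [MeasurableSpace ((UnitaryGroup.cmDatum L 3 H').Local v)] [BorelSpace ((UnitaryGroup.cmDatum L 3 H').Local v)]
      [∀ γ : (UnitaryGroup.cmDatum L 3 H').Local v, MeasurableSpace ((UnitaryGroup.cmDatum L 3 H').Local v ⧸ Subgroup.centralizer ({γ} : Set ((UnitaryGroup.cmDatum L 3 H').Local v)))]
      [∀ γ : (UnitaryGroup.cmDatum L 3 H').Local v, BorelSpace ((UnitaryGroup.cmDatum L 3 H').Local v ⧸ Subgroup.centralizer ({γ} : Set ((UnitaryGroup.cmDatum L 3 H').Local v)))]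
      (νHv : Measure ((UnitaryGroup.cmDatum L 2 (Matrix.of fun i j : Fin 2 => if i.val + j.val + 1 = 2 then (1 : L) else 0)).Local v × (UnitaryGroup.cmDatum L 1 (Matrix.of fun i j : Fin 1 => if i.val + j.val + 1 = 1 then (1 : L) else 0)).Local v)) (νGv : Measure ((UnitaryGroup.cmDatum L 3 H').Local v))
      [IsFiniteMeasureOnCompacts νHv] [νHv.IsMulRightInvariant] [νGv.IsHaarMeasure] [νGv.IsMulRightInvariant]
      (Δv : LocalTransferFactor L H' v)
      (mHv : OrbitalMeasureFamily ((UnitaryGroup.cmDatum L 2 (Matrix.of fun i j : Fin 2 => if i.val + j.val + 1 = 2 then (1 : L) else 0)).Local v × (UnitaryGroup.cmDatum L 1 (Matrix.of fun i j : Fin 1 => if i.val + j.val + 1 = 1 then (1 : L) else 0)).Local v)) (mGv : OrbitalMeasureFamily ((UnitaryGroup.cmDatum L 3 H').Local v)),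
      IsLocalTransferDatum L H' v Δv mHv mGv →
      mHv.IsCanonical (IsLocalGRegular L v) νHv →
      mGv.IsCanonical (fun γ : (UnitaryGroup.cmDatum L 3 H').Local v => IsRegularElt (γ.val : GL (Fin 3) (UnitaryGroup.LocalRing L v))) νGv →
      Subsingleton (UnitaryGroup.PlacesOver L v) →
    ∀ z : (UnitaryGroup.cmDatum L 2 (Matrix.of fun i j : Fin 2 => if i.val + j.val + 1 = 2 then (1 : L) else 0)).Local v × (UnitaryGroup.cmDatum L 1 (Matrix.of fun i j : Fin 1 => if i.val + j.val + 1 = 1 then (1 : L) else 0)).Local v, z ∈ Subgroup.center ((UnitaryGroup.cmDatum L 2 (Matrix.of fun i j : Fin 2 => if i.val + j.val + 1 = 2 then (1 : L) else 0)).Local v × (UnitaryGroup.cmDatum L 1 (Matrix.of fun i j : Fin 1 => if i.val + j.val + 1 = 1 then (1 : L) else 0)).Local v) →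
    ∃ (f₀ : (UnitaryGroup.cmDatum L 2 (Matrix.of fun i j : Fin 2 => if i.val + j.val + 1 = 2 then (1 : L) else 0)).Local v × (UnitaryGroup.cmDatum L 1 (Matrix.of fun i j : Fin 1 => if i.val + j.val + 1 = 1 then (1 : L) else 0)).Local v → ℂ) (r κ : ℝ), IsLocSmooth f₀ ∧ 0 < r ∧ f₀ z = -(r : ℂ) ∧ 0 < κ ∧
      (∀ γ : (UnitaryGroup.cmDatum L 2 (Matrix.of fun i j : Fin 2 => if i.val + j.val + 1 = 2 then (1 : L) else 0)).Local v × (UnitaryGroup.cmDatum L 1 (Matrix.of fun i j : Fin 1 => if i.val + j.val + 1 = 1 then (1 : L) else 0)).Local v, IsLocalGRegular L v γ →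
        CompactSpace (Subgroup.centralizer ({γ} : Set ((UnitaryGroup.cmDatum L 2 (Matrix.of fun i j : Fin 2 => if i.val + j.val + 1 = 2 then (1 : L) else 0)).Local v × (UnitaryGroup.cmDatum L 1 (Matrix.of fun i j : Fin 1 => if i.val + j.val + 1 = 1 then (1 : L) else 0)).Local v))) →
        classOrbitalIntegral mHv f₀ (ConjClasses.mk γ) = (κ : ℂ)) := by
  intro L _ _ _ H' hherm hanis v _ _ _ _ _ _ _ _ νHv νGv _ _ _ _ Δv mHv mGv hLTD hcanH _ hsub z hz
  classical
  obtain ⟨w⟩ : Nonempty (UnitaryGroup.PlacesOver L v) := inferInstance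
  have hw : IsCMField.complexConj L • w.1 = w.1 := smul_eq_of_subsingleton_placesOver L hsub w
  have hns : ∀ w' : UnitaryGroup.PlacesOver L v, IsCMField.complexConj L • w'.1 = w'.1 := fun w' => smul_eq_of_subsingleton_placesOver L hsub w'
  -- §1 `νHv ≠ 0` (admissibility of the canonical `mHv` at a `G`-regular class), hence `νHv` is a Haar measure (`H_v` is unimodular)
  have hne : νHv ≠ 0 := by
    intro hv0
    obtain ⟨γH', -, hreg', -⟩ := K2E4WeakMatrixAlmostEverywhereAgreement.exists_isGRegular_isNormPair (L := L) H' hherm hanis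
    have hP := isLocalGRegular_out_mk_rationalComponent L γH' hreg' v
    obtain ⟨t₀, ht₀, hti₀, -, hm⟩ := hcanH _ hP
    have hzz := (hLTD.2.1 _ hP).1
    rw [hm] at hzz
    exact hzz (quotientMeasure_eq_zero_of_eq_zero _ _ t₀ νHv hv0)
  haveI : νHv.IsHaarMeasure := by
    haveI : (Measure.haar : Measure ((UnitaryGroup.cmDatum L 2 (Matrix.of fun i j : Fin 2 => if i.val + j.val + 1 = 2 then (1 : L) else 0)).Local v × (UnitaryGroup.cmDatum L 1 (Matrix.of fun i j : Fin 1 => if i.val + j.val + 1 = 1 then (1 : L) else 0)).Local v)).IsInvInvariant := UnitaryGroup.isInvInvariant_localEndoscopic L v Measure.haar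
    haveI : (Measure.haar : Measure ((UnitaryGroup.cmDatum L 2 (Matrix.of fun i j : Fin 2 => if i.val + j.val + 1 = 2 then (1 : L) else 0)).Local v × (UnitaryGroup.cmDatum L 1 (Matrix.of fun i j : Fin 1 => if i.val + j.val + 1 = 1 then (1 : L) else 0)).Local v)).IsMulRightInvariant := by
      rw [← Measure.inv_eq_self (Measure.haar : Measure ((UnitaryGroup.cmDatum L 2 (Matrix.of fun i j : Fin 2 => if i.val + j.val + 1 = 2 then (1 : L) else 0)).Local v × (UnitaryGroup.cmDatum L 1 (Matrix.of fun i j : Fin 1 => if i.val + j.val + 1 = 1 then (1 : L) else 0)).Local v))]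
      infer_instance
    exact isHaarMeasure_of_isMulRightInvariant_of_ne_zero Measure.haar νHv hne
  -- §2 the Borel structure on `H_v` is the product of the Borel structures of the factors; `U(Φ₁)(L⁺_v)` is compact
  letI iU₂ : MeasurableSpace ((UnitaryGroup.cmDatum L 2 (Matrix.of fun i j : Fin 2 => if i.val + j.val + 1 = 2 then (1 : L) else 0)).Local v) := borel _
  haveI : BorelSpace ((UnitaryGroup.cmDatum L 2 (Matrix.of fun i j : Fin 2 => if i.val + j.val + 1 = 2 then (1 : L) else 0)).Local v) := ⟨rfl⟩
  letI iU₁ : MeasurableSpace ((UnitaryGroup.cmDatum L 1 (Matrix.of fun i j : Fin 1 => if i.val + j.val + 1 = 1 then (1 : L) else 0)).Local v) := borel _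
  haveI : BorelSpace ((UnitaryGroup.cmDatum L 1 (Matrix.of fun i j : Fin 1 => if i.val + j.val + 1 = 1 then (1 : L) else 0)).Local v) := ⟨rfl⟩
  have hHB : ‹MeasurableSpace ((UnitaryGroup.cmDatum L 2 (Matrix.of fun i j : Fin 2 => if i.val + j.val + 1 = 2 then (1 : L) else 0)).Local v × (UnitaryGroup.cmDatum L 1 (Matrix.of fun i j : Fin 1 => if i.val + j.val + 1 = 1 then (1 : L) else 0)).Local v)› = Prod.instMeasurableSpace :=
    (@BorelSpace.measurable_eq ((UnitaryGroup.cmDatum L 2 (Matrix.of fun i j : Fin 2 => if i.val + j.val + 1 = 2 then (1 : L) else 0)).Local v × (UnitaryGroup.cmDatum L 1 (Matrix.of fun i j : Fin 1 => if i.val + j.val + 1 = 1 then (1 : L) else 0)).Local v) _ ‹MeasurableSpace ((UnitaryGroup.cmDatum L 2 (Matrix.of fun i j : Fin 2 => if i.val + j.val + 1 = 2 then (1 : L) else 0)).Local v × (UnitaryGroup.cmDatum L 1 (Matrix.of fun i j : Fin 1 => if i.val + j.val + 1 = 1 then (1 : L) else 0)).Local v)› ‹BorelSpace ((UnitaryGroup.cmDatum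 L 2 (Matrix.of fun i j : Fin 2 => if i.val + j.val + 1 = 2 then (1 : L) else 0)).Local v × (UnitaryGroup.cmDatum L 1 (Matrix.of fun i j : Fin 1 => if i.val + j.val + 1 = 1 then (1 : L) else 0)).Local v)›).trans
      (@BorelSpace.measurable_eq ((UnitaryGroup.cmDatum L 2 (Matrix.of fun i j : Fin 2 => if i.val + j.val + 1 = 2 then (1 : L) else 0)).Local v × (UnitaryGroup.cmDatum L 1 (Matrix.of fun i j : Fin 1 => if i.val + j.val + 1 = 1 then (1 : L) else 0)).Local v) _ Prod.instMeasurableSpace Prod.borelSpace).symm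
  subst hHB
  letI : ∀ γ : (UnitaryGroup.cmDatum L 2 (Matrix.of fun i j : Fin 2 => if i.val + j.val + 1 = 2 then (1 : L) else 0)).Local v, MeasurableSpace (((UnitaryGroup.cmDatum L 2 (Matrix.of fun i j : Fin 2 => if i.val + j.val + 1 = 2 then (1 : L) else 0)).Local v) ⧸ Subgroup.centralizer ({γ} : Set ((UnitaryGroup.cmDatum L 2 (Matrix.of fun i j : Fin 2 => if i.val + j.val + 1 = 2 then (1 : L) else 0)).Local v))) := fun _ => borel _
  haveI : ∀ γ : (UnitaryGroup.cmDatum L 2 (Matrix.of fun i j : Fin 2 => if i.val + j.val + 1 = 2 then (1 : L) else 0)).Local v, BorelSpace (((UnitaryGroup.cmDatum L 2 (Matrix.of fun i j : Fin 2 => if i.val + j.val + 1 = 2 then (1 : L) else 0)).Local v) ⧸ Subgroup.centralizer ({γ} : Set ((UnitaryGroup.cmDatum L 2 (Matrix.of fun i j : Fin 2 => if i.val + j.val + 1 = 2 then (1 : L) else 0)).Local v))) := fun _ => ⟨rfl⟩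
  haveI : CompactSpace ((UnitaryGroup.cmDatum L 1 (Matrix.of fun i j : Fin 1 => if i.val + j.val + 1 = 1 then (1 : L) else 0)).Local v) := Literature.NumberTheory.Rogawski1990.compactSpace_cmDatum_local_one_of_smul_eq L v w hw
  -- §3 the auxiliary Haar measure `(pr₁)_* νHv` on `U₂` and a canonical family for it
  obtain ⟨hν₂H, hν₂R⟩ := isHaarMeasure_map_fst_of_compactSpace L v νHv
  haveI := hν₂H
  haveI := hν₂R
  obtain ⟨-, m₂, hcan₂⟩ := exists_isCanonical_cmDatum_local_two L v (Measure.map (Prod.fst : ((UnitaryGroup.cmDatum L 2 (Matrix.of fun i j : Fin 2 => if i.val + j.val + 1 = 2 then (1 : L) else 0)).Local v × (UnitaryGroup.cmDatum L 1 (Matrix.of fun i j : Fin 1 => if i.val + j.val + 1 = 1 then (1 : L) else 0)).Local v) → ((UnitaryGroup.cmDatum L 2 (Matrix.of fun i j : Fin 2 => if i.val + j.val + 1 = 2 then (1 : L) else 0)).Local v)) νHv)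
  -- §4 Kottwitz's EP function on `U₂` with its negative central value (★ J2♯), pulled back along `pr₁`
  obtain ⟨f, hf, h1, -, r, hr, hval⟩ := rankOneEulerPoincareNonsplit_withCentralValue L v hsub (Measure.map (Prod.fst : ((UnitaryGroup.cmDatum L 2 (Matrix.of fun i j : Fin 2 => if i.val + j.val + 1 = 2 then (1 : L) else 0)).Local v × (UnitaryGroup.cmDatum L 1 (Matrix.of fun i j : Fin 1 => if i.val + j.val + 1 = 1 then (1 : L) else 0)).Local v) → ((UnitaryGroup.cmDatum L 2 (Matrix.of fun i j : Fin 2 => if i.val + j.val + 1 = 2 then (1 : L) else 0)).Local v)) νHv) m₂ hcan₂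
  refine ⟨fun p => f p.1, r, 1, (isLocSmooth_iff _).2 ⟨hf.isLocallyConstant.comp_continuous continuous_fst, ?_⟩, hr, ?_, one_pos, fun γ hγ hZ => ?_⟩
  · -- compact support: `supp (f ∘ pr₁) ⊆ tsupport f × U(Φ₁)(L⁺_v)`
    refine HasCompactSupport.intro (hf.hasCompactSupport.isCompact.prod isCompact_univ) fun p hp => ?_
    have hp1 : p.1 ∉ tsupport f := fun h => hp (Set.mk_mem_prod h (Set.mem_univ _))
    exact image_eq_zero_of_notMem_tsupport hp1
  · -- the central value: `z.1` is central in `U₂`, hence a unit scalar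
    have hz1 : z.1 ∈ Subgroup.center ((UnitaryGroup.cmDatum L 2 (Matrix.of fun i j : Fin 2 => if i.val + j.val + 1 = 2 then (1 : L) else 0)).Local v) := by
      rw [Subgroup.mem_center_iff]
      intro g
      have h := Subgroup.mem_center_iff.1 hz (g, 1)
      simpa using congrArg Prod.fst h
    obtain ⟨u, hu⟩ := UnitaryGroup.forall_mem_center_cmLocal_eq_scalar L (Matrix.of fun i j : Fin 2 => if i.val + j.val + 1 = 2 then (1 : L) else 0) (UnitaryGroup.antidiagOne_isHermitian L 2)
      (UnitaryGroup.isUnit_antidiagOne_det L 2) v hns z.1 hz1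
    refine hval z.1 (u : UnitaryGroup.LocalRing L v) ?_
    have hu' : (z.1.val : GL (Fin 2) (UnitaryGroup.LocalRing L v)) = Matrix.GeneralLinearGroup.scalar (Fin 2) u := hu
    rw [hu', Matrix.GeneralLinearGroup.coe_scalar, Matrix.scalar_apply, Matrix.smul_one_eq_diagonal]
  · -- the orbital integral at an elliptic `G`-regular class: PAIR for canonical families, then (E) on `U₂`
    haveI := hZ
    haveI := F0P3cStCharTSEllMassHOrbEll.compactSpace_centralizer_fst_of_centralizerH L v γ
    have hreg := (isRegularElt_fst_snd_of_isLocalGRegular L v γ hγ).1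
    have hc : IsLocalGRegular L v (Quotient.out (ConjClasses.mk (γ.1, γ.2))) := isLocalGRegular_of_isConj (isConj_out_conjClasses_mk _) hγ
    have hc₁ : IsRegularElt ((Quotient.out (ConjClasses.mk γ.1)).val : GL (Fin 2) (UnitaryGroup.LocalRing L v)) := isRegularElt_out_mk_local (L := L) hreg
    have hpair := hcanH.classOrbitalIntegral_comp_fst_eq_of_compactSpace_of_map_fst νHv (Measure.map (Prod.fst : ((UnitaryGroup.cmDatum L 2 (Matrix.of fun i j : Fin 2 => if i.val + j.val + 1 = 2 then (1 : L) else 0)).Local v × (UnitaryGroup.cmDatum L 1 (Matrix.of fun i j : Fin 1 => if i.val + j.val + 1 = 1 then (1 : L) else 0)).Local v) → ((UnitaryGroup.cmDatum L 2 (Matrix.of fun i j : Fin 2 => if i.val + j.val + 1 = 2 then (1 : L) else 0)).Local v)) νHv) rfl hcan₂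
      γ.1 γ.2 hc hc₁ hf.continuous
    rw [Complex.ofReal_one]
    exact hpair.trans (h1 γ.1 hreg inferInstance)

end Summit.HodgeConjecture.HodgeConjecture.Cruxes.H413.K2E3CentralGermEPWitness

end
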